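import Literature.Computability.Complexity.StackBricks
import Literature.Computability.Complexity.StackLists
import Literature.Computability.Complexity.StackRoutines
import HarnessLib

/-!
# List bricks: re-parsing a coded list and sorting it, as `FP` string functions

Trunk `CplxCore`, continuing `StackBricks.lean` (`Brick.unOp_mem_FP`) over `StackLists.lean`
(`encList`, the coding of a list of strings by nested pairs; `Com.emit`; `Com.isort`, insertion
sort by value with the model `isortModel`). The sort is verified there for a register holding a
genuine code `encList l`; an `FP` brick must be total, so it is prefixed here by a **re-parsing
pass** that turns an arbitrary string `a` into the code of the list it denotes:

* `Brick.rpStep`, `Brick.decItems a` — the total decoder: split off pair components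
  (`boolUnpair`) while the string is a well-formed pair (`wellPaired`), `|a|` times;
  `decItems (encList l) = l` (`decItems_encList`);
* `Brick.reparseC` / `runs_reparse`: `src := encList (decItems a)` in quadratic time;
* `isortFn a = encList (isortModel [] (decItems a))` and **`isortFn_mem_FP`**; on a code,
  `isortFn (encList l) = encList (isortModel [] l)`.

## References

* T. H. Cormen, C. E. Leiserson, R. L. Rivest, C. Stein, *Introduction to Algorithms*, 3rd ed.,
  MIT Press 2009, §2.1 (insertion sort).
* S. Arora, B. Barak, *Computational Complexity: A Modern Approach*, CUP 2009, §0.1, §1.3.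
-/

namespace Literature.Computability.Complexity

open _root_.Computability AReg
open Com (LIx outRev outRev_append reverse_outRev encList_eq_flatMap length_le_length_encList isortModel perm_isortModel isortStepCost insCost)

namespace Brick

-- `Sum.elim_update_left/right` loop against `Sum.update_elim_inl/inr` on register files.
attribute [-simp] Sum.elim_update_left Sum.elim_update_right

/-! ### The total decoder of coded lists -/

/-- State of the re-parse: the unread string, the items read, the stop latch. [folklore] -/
abbrev RpState := List Bool × List (List Bool) × Bool

/-- One re-parse step: stopped stays stopped; a well-formed pair gives an item; anything else
stops (and is discarded). [folklore] -/
def rpStep (s : RpState) : RpState :=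
  if s.2.2 then s
  else if wellPaired s.1 then ((boolUnpair s.1).2, s.2.1 ++ [(boolUnpair s.1).1], false)
  else ([], s.2.1, true)

/-- The list of strings denoted by an arbitrary string (`|a|` re-parse steps). [folklore] -/
def decItems (a : List Bool) : List (List Bool) := (rpStep^[a.length] (a, [], false)).2.1

/-- Re-parsing a code reads its items, then stops. [folklore] -/
theorem rpStep_iterate_encList : ∀ (l E : List (List Bool)) (k : ℕ), l.length ≤ k →
    (rpStep^[k] (encList l, E, false)).2.1 = E ++ l ∧ (rpStep^[k] (encList l, E, false)).1 = []
  | [], E, 0, _ => by simp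
  | [], E, k + 1, _ => by
    rw [Function.iterate_succ_apply]
    have h1 : rpStep (encList [], E, false) = ([], E, true) := by simp [rpStep]
    rw [h1]
    have : rpStep^[k] (([] : List Bool), E, true) = ([], E, true) := Function.iterate_fixed (by simp [rpStep]) k
    simp [this]
  | a :: l, E, 0, h => by simp at h
  | a :: l, E, k + 1, h => by
    rw [Function.iterate_succ_apply]
    have h1 : rpStep (encList (a :: l), E, false) = (encList l, E ++ [a], false) := by
      simp [rpStep, wellPaired_encList, boolUnpair_encList_cons]
    rw [h1]
    obtain ⟨h2, h3⟩ := rpStep_iterate_encList l (E ++ [a]) k (by simp at h; omega)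
    exact ⟨by rw [h2]; simp, h3⟩

/-- **The decoder inverts the coding**: `decItems (encList l) = l`. [folklore] -/
theorem decItems_encList (l : List (List Bool)) : decItems (encList l) = l := by
  have := (rpStep_iterate_encList l [] (encList l).length (length_le_length_encList l)).1
  simpa [decItems] using this

/-- Size along the re-parse: unread string plus code of the items read never grows. [folklore] -/
theorem size_rpStep_le (s : RpState) : (rpStep s).1.length + (encList (rpStep s).2.1).length ≤ s.1.length + (encList s.2.1).length := by
  unfold rpStep
  split_ifs with h1 h2
  · exact le_rfl
  · obtain ⟨u, v, huv⟩ := (wellPaired_iff s.1).1 h2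
    simp only [huv, boolUnpair_boolPair, encList_eq_flatMap, List.flatMap_append, List.flatMap_cons, List.flatMap_nil,
      List.append_nil, List.length_append, length_boolPair, List.length_cons, List.length_nil, List.length_flatMap]
    simp; omega
  · simp

/-- Size after `k` re-parse steps. [folklore] -/
theorem size_rpStep_iterate_le (a : List Bool) : ∀ k : ℕ,
    (rpStep^[k] (a, [], false)).1.length + (encList (rpStep^[k] (a, [], false)).2.1).length ≤ a.length
  | 0 => by simp
  | k + 1 => by
    rw [Function.iterate_succ_apply']
    exact (size_rpStep_le _).trans (size_rpStep_iterate_le a k)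

/-- The code of the decoded list is no longer than the string. [folklore] -/
theorem length_encList_decItems_le (a : List Bool) : (encList (decItems a)).length ≤ a.length :=
  (Nat.le_add_left _ _).trans (size_rpStep_iterate_le a a.length)

/-! ### The re-parsing program -/

/-- The roles of `StackLists.LIx` used directly as the register type. [folklore] -/
def rI : LIx ↪ LIx := ⟨id, fun _ _ h => h⟩

/-- The identity realisation of the roles. [folklore] -/
@[simp] theorem rI_apply (i : LIx) : rI i = i := rfl

/-- The register file of a re-parse state: unread string on `INS`, items (coded, reversed) on
`outR`, latch on `DN`, the loop register `F`. [folklore] -/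
def rfile (cur : List Bool) (E : List (List Bool)) (dn : Bool) (v : List Bool) : Regs LIx := fun i =>
  match i with
  | .INS => cur
  | .outR => outRev E
  | .DN => flag dn
  | .F => v
  | _ => []

/-- The re-parse loop body: unless stopped, split the unread string; on a well-formed pair keep
the rest and emit the item; otherwise stop and discard. [folklore] -/
def rpBody : Com (LIx ⊕ AReg) :=
  Com.ifFlag (Sum.inl .DN) Com.skip
    (Com.unpairW (Sum.inl .INS) (Sum.inl .A) (Sum.inl .T) (Sum.inl .M) (Sum.inl .P) ;;
      Com.pop (Sum.inl .M)
        (Com.pour (Sum.inl .T) (Sum.inl .INS) ;; (Com.pour (Sum.inl .A) (Sum.inl .H) ;; Com.emit (Sum.inl .H) (Sum.inl .outR)))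
        Com.skip
        (Com.push (Sum.inl .DN) true ;; (Com.clear (Sum.inl .A) ;; Com.clear (Sum.inl .T))))

/-- **One iteration of the re-parse loop** realises `rpStep`, in `17 |cur| + 19` steps.
[folklore] -/
theorem runs_rpBody (cur : List Bool) (E : List (List Bool)) (dn : Bool) (v zz : List Bool) :
    Com.Runs rpBody (Sum.elim (rfile cur E dn v) (file [] [] zz [] [] [] [] []))
      (Sum.elim (rfile (rpStep (cur, E, dn)).1 (rpStep (cur, E, dn)).2.1 (rpStep (cur, E, dn)).2.2 v) (file [] [] zz [] [] [] [] []))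
      (17 * cur.length + 19) := by
  cases dn
  · -- running
    have hd : [(Sum.inl LIx.INS : LIx ⊕ AReg), Sum.inl .A, Sum.inl .T, Sum.inl .M, Sum.inl .P].Nodup := by simp
    have h1 := Com.runs_unpairW hd (Sum.elim (rfile cur E false v) (file [] [] zz [] [] [] [] [])) (by rfl) (by rfl)
    simp only [Sum.elim_inl] at h1
    set it := (boolUnpair cur).1 with hit
    set rest := (boolUnpair cur).2 with hrest
    have hlen : 2 * it.length + rest.length ≤ cur.length := by
      rw [hit, hrest]; exact length_boolUnpair_parts_le cur
    -- the file after `unpairW`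
    set R1 : Regs (LIx ⊕ AReg) := Sum.elim (fun i => match i with
      | .A => it.reverse | .T => rest.reverse | .M => flag (wellPaired cur) | .outR => outRev E | .F => v | _ => [])
      (file [] [] zz [] [] [] [] []) with hR1
    have e1 : Function.update (Function.update (Function.update (Function.update (Function.update
        (Sum.elim (rfile cur E false v) (file [] [] zz [] [] [] [] [])) (Sum.inl LIx.INS) []) (Sum.inl LIx.A)
        (it.reverse ++ (rfile cur E false v) LIx.A)) (Sum.inl LIx.T) (rest.reverse ++ (rfile cur E false v) LIx.T))
        (Sum.inl LIx.M) (flag (wellPaired cur))) (Sum.inl LIx.P) [] = R1 := by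
      rw [hR1]; funext i; rcases i with i | i
      · cases i <;> simp [rfile]
      · cases i <;> simp
    rw [show (rfile cur E false v) LIx.INS = cur from rfl, e1] at h1
    by_cases hw : wellPaired cur = true
    · -- an item
      have hstep : rpStep (cur, E, false) = (rest, E ++ [it], false) := by simp [rpStep, hw, hit, hrest]
      rw [hstep]
      set R2 : Regs (LIx ⊕ AReg) := Sum.elim (fun i => match i with
        | .A => it.reverse | .T => rest.reverse | .outR => outRev E | .F => v | _ => []) (file [] [] zz [] [] [] [] []) with hR2
      have hM : R1 (Sum.inl LIx.M) = true :: [] := by simp [hR1, hw]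
      have hw2 : Function.update R1 (Sum.inl LIx.M) [] = R2 := by
        rw [hR1, hR2]; funext i; rcases i with i | i
        · cases i <;> simp
        · cases i <;> simp
      -- pour T INS
      set R3 : Regs (LIx ⊕ AReg) := Sum.elim (fun i => match i with
        | .A => it.reverse | .INS => rest | .outR => outRev E | .F => v | _ => []) (file [] [] zz [] [] [] [] []) with hR3
      have h3 : Com.Runs (Com.pour (Sum.inl .T) (Sum.inl .INS) : Com (LIx ⊕ AReg)) R2 R3 (3 * rest.length + 1) := by
        refine (Com.runs_pour (a := (Sum.inl LIx.T : LIx ⊕ AReg)) (b := Sum.inl LIx.INS) (by simp) R2).of_eq ?_ (by simp [hR2])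
        rw [hR2, hR3]; funext i; rcases i with i | i
        · cases i <;> simp
        · cases i <;> simp
      -- pour A H
      set R4 : Regs (LIx ⊕ AReg) := Sum.elim (fun i => match i with
        | .H => it | .INS => rest | .outR => outRev E | .F => v | _ => []) (file [] [] zz [] [] [] [] []) with hR4
      have h4 : Com.Runs (Com.pour (Sum.inl .A) (Sum.inl .H) : Com (LIx ⊕ AReg)) R3 R4 (3 * it.length + 1) := by
        refine (Com.runs_pour (a := (Sum.inl LIx.A : LIx ⊕ AReg)) (b := Sum.inl LIx.H) (by simp) R3).of_eq ?_ (by simp [hR3])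
        rw [hR3, hR4]; funext i; rcases i with i | i
        · cases i <;> simp
        · cases i <;> simp
      -- emit H outR
      have h5 : Com.Runs (Com.emit (Sum.inl .H) (Sum.inl .outR) : Com (LIx ⊕ AReg)) R4
          (Sum.elim (rfile rest (E ++ [it]) false v) (file [] [] zz [] [] [] [] [])) (4 * it.length + 3) := by
        refine (Com.runs_emit (h := (Sum.inl LIx.H : LIx ⊕ AReg)) (o := Sum.inl LIx.outR) (by simp) R4).of_eq ?_ (by simp [hR4])
        rw [hR4]; funext i; rcases i with i | i
        · cases i <;> simp [rfile, outRev_append]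
        · cases i <;> simp
      have hbr : Com.Runs (Com.pop (Sum.inl .M)
            (Com.pour (Sum.inl .T) (Sum.inl .INS) ;; (Com.pour (Sum.inl .A) (Sum.inl .H) ;; Com.emit (Sum.inl .H) (Sum.inl .outR)))
            Com.skip (Com.push (Sum.inl .DN) true ;; (Com.clear (Sum.inl .A) ;; Com.clear (Sum.inl .T))) : Com (LIx ⊕ AReg)) R1
          (Sum.elim (rfile rest (E ++ [it]) false v) (file [] [] zz [] [] [] [] [])) (3 * rest.length + 1 + (3 * it.length + 1 + (4 * it.length + 3)) + 2) :=
        Com.Runs.pop_true _ _ hM (by rw [hw2]; exact h3.seq (h4.seq h5))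
      exact (Com.runs_ifFlag_false Com.skip (by rfl) (h1.seq hbr)).mono (by omega)
    · -- stop
      rw [Bool.not_eq_true] at hw
      have hstep : rpStep (cur, E, false) = ([], E, true) := by simp [rpStep, hw]
      rw [hstep]
      have hM : R1 (Sum.inl LIx.M) = [] := by simp [hR1, hw]
      set R2 : Regs (LIx ⊕ AReg) := Sum.elim (fun i => match i with
        | .A => it.reverse | .T => rest.reverse | .outR => outRev E | .F => v | .DN => [true] | _ => [])
        (file [] [] zz [] [] [] [] []) with hR2
      have h2 : Com.Runs (Com.push (Sum.inl .DN) true : Com (LIx ⊕ AReg)) R1 R2 1 := by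
        refine Com.Runs.push' ?_
        rw [hR1, hR2]; funext i; rcases i with i | i
        · cases i <;> simp [hw]
        · cases i <;> simp
      set R3 : Regs (LIx ⊕ AReg) := Sum.elim (fun i => match i with
        | .T => rest.reverse | .outR => outRev E | .F => v | .DN => [true] | _ => []) (file [] [] zz [] [] [] [] []) with hR3
      have h3 : Com.Runs (Com.clear (Sum.inl .A) : Com (LIx ⊕ AReg)) R2 R3 (2 * it.length + 1) := by
        refine (Com.runs_clear (Sum.inl LIx.A : LIx ⊕ AReg) R2).of_eq ?_ (by simp [hR2])
        rw [hR2, hR3]; funext i; rcases i with i | i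
        · cases i <;> simp
        · cases i <;> simp
      have h4 : Com.Runs (Com.clear (Sum.inl .T) : Com (LIx ⊕ AReg)) R3
          (Sum.elim (rfile [] E true v) (file [] [] zz [] [] [] [] [])) (2 * rest.length + 1) := by
        refine (Com.runs_clear (Sum.inl LIx.T : LIx ⊕ AReg) R3).of_eq ?_ (by simp [hR3])
        rw [hR3]; funext i; rcases i with i | i
        · cases i <;> simp [rfile]
        · cases i <;> simp
      have hbr : Com.Runs (Com.pop (Sum.inl .M)
            (Com.pour (Sum.inl .T) (Sum.inl .INS) ;; (Com.pour (Sum.inl .A) (Sum.inl .H) ;; Com.emit (Sum.inl .H) (Sum.inl .outR)))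
            Com.skip (Com.push (Sum.inl .DN) true ;; (Com.clear (Sum.inl .A) ;; Com.clear (Sum.inl .T))) : Com (LIx ⊕ AReg)) R1
          (Sum.elim (rfile [] E true v) (file [] [] zz [] [] [] [] [])) (1 + (2 * it.length + 1 + (2 * rest.length + 1)) + 2) :=
        Com.Runs.pop_nil _ _ hM (h2.seq (h3.seq h4))
      exact (Com.runs_ifFlag_false Com.skip (by rfl) (h1.seq hbr)).mono (by omega)
  · -- stopped
    have hstep : rpStep (cur, E, true) = (cur, E, true) := by simp [rpStep]
    rw [hstep]
    have h : Com.Runs rpBody (Sum.elim (rfile cur E true v) (file [] [] zz [] [] [] [] []))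
        (Sum.elim (rfile cur E true v) (file [] [] zz [] [] [] [] [])) (0 + 3) := by
      unfold rpBody
      exact Com.runs_ifFlag (F := (Sum.inl LIx.DN : LIx ⊕ AReg)) (b := true)
        (R := Sum.elim (rfile cur E true v) (file [] [] zz [] [] [] [] [])) rfl (fun _ => Com.Runs.skip _)
        (fun h => absurd h (by decide))
    exact h.mono (by omega)

/-- `reparseC`: clock `|a|` iterations of `rpBody` by a copy of the input, then lay the code of
the decoded list on `src` and clean up. [folklore] -/
def reparseC : Com (LIx ⊕ AReg) :=
  Com.copy (Sum.inl .INS) (Sum.inl .F) (Sum.inr .s) (Sum.inr .t) ;;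
    (Com.loop (Sum.inl .F) rpBody rpBody ;;
    (Com.pour (Sum.inl .outR) (Sum.inl .src) ;; (Com.clear (Sum.inl .INS) ;; Com.clear (Sum.inl .DN))))

/-- The file after re-parsing: the code of the decoded list on `src`, everything else empty.
[folklore] -/
def srcFile (w : List Bool) : Regs LIx := Function.update (fun _ => []) .src w

/-- **Effect of `reparseC`** from the input `a` on `INS` (everything else empty):
`src := encList (decItems a)`, within `|a| (17|a| + 21) + 20|a| + 12` steps. [folklore] -/
theorem runs_reparse (a zz : List Bool) :
    Com.Runs reparseC (Sum.elim (rfile a [] false []) (file [] [] zz [] [] [] [] []))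
      (Sum.elim (srcFile (encList (decItems a))) (file [] [] zz [] [] [] [] []))
      (a.length * (17 * a.length + 21) + 20 * a.length + 12) := by
  -- the clock
  have h1 : Com.Runs (Com.copy (Sum.inl .INS) (Sum.inl .F) (Sum.inr .s) (Sum.inr .t) : Com (LIx ⊕ AReg))
      (Sum.elim (rfile a [] false []) (file [] [] zz [] [] [] [] []))
      (Function.update (Sum.elim (rfile a [] false []) (file [] [] zz [] [] [] [] [])) (Sum.inl .F) a) (10 * a.length + 3) :=
    (Com.runs_copy (a := (Sum.inl LIx.INS : LIx ⊕ AReg)) (b := Sum.inl LIx.F) (t := Sum.inr AReg.s) (u := Sum.inr AReg.t)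
      (by simp) (by simp) (by simp) (by simp) (by simp) (by simp) _ rfl rfl).of_eq (by simp [rfile]) (by simp [rfile])
  -- the loop
  let st : ℕ → RpState := fun i => rpStep^[i] (a, [], false)
  let Φ : ℕ → Regs (LIx ⊕ AReg) := fun i => Sum.elim (rfile (st i).1 (st i).2.1 (st i).2.2 []) (file [] [] zz [] [] [] [] [])
  have hΦ : ∀ i, Φ i (Sum.inl .F) = [] := fun i => rfl
  have hupd : ∀ (i : ℕ) (w : List Bool), Function.update (Φ i) (Sum.inl .F) w =
      Sum.elim (rfile (st i).1 (st i).2.1 (st i).2.2 w) (file [] [] zz [] [] [] [] []) := by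
    intro i w; funext j; rcases j with j | j
    · cases j <;> simp [Φ, rfile]
    · cases j <;> simp [Φ]
  have hcur : ∀ i, (st i).1.length ≤ a.length := fun i =>
    (Nat.le_add_right _ _).trans (size_rpStep_iterate_le a i)
  have hbody : ∀ i, 0 ≤ i → i < 0 + a.length → ∀ w : List Bool,
      Com.Runs rpBody (Function.update (Φ i) (Sum.inl .F) w) (Function.update (Φ (i + 1)) (Sum.inl .F) w) (17 * a.length + 19) := by
    intro i _ _ w
    rw [hupd, hupd]
    have h := runs_rpBody (st i).1 (st i).2.1 (st i).2.2 w zz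
    have e : st (i + 1) = rpStep (st i) := Function.iterate_succ_apply' rpStep i _
    rw [e]
    exact h.mono (by have := hcur i; omega)
  have h2 := Com.runs_indexLoop (c := (Sum.inl LIx.F : LIx ⊕ AReg)) (body := rpBody) Φ (17 * a.length + 19) hΦ a 0 hbody
  rw [Nat.zero_add] at h2
  have e0 : Function.update (Φ 0) (Sum.inl .F) a = Function.update (Sum.elim (rfile a [] false []) (file [] [] zz [] [] [] [] [])) (Sum.inl .F) a := by
    simp [Φ, st]
  rw [e0] at h2
  -- lay out the result
  set items := (st a.length).2.1 with hitems
  have hdec : decItems a = items := rfl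
  set cur := (st a.length).1 with hcurdef
  set dn := (st a.length).2.2 with hdn
  have hΦa : Φ a.length = Sum.elim (rfile cur items dn []) (file [] [] zz [] [] [] [] []) := rfl
  rw [hΦa] at h2
  have hsz : cur.length + (encList items).length ≤ a.length := size_rpStep_iterate_le a a.length
  set R3 : Regs (LIx ⊕ AReg) := Sum.elim (fun i => match i with | .INS => cur | .DN => flag dn | .src => encList items | _ => [])
    (file [] [] zz [] [] [] [] []) with hR3
  have h3 : Com.Runs (Com.pour (Sum.inl .outR) (Sum.inl .src) : Com (LIx ⊕ AReg)) (Sum.elim (rfile cur items dn []) (file [] [] zz [] [] [] [] [])) R3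
      (3 * (encList items).length + 1) := by
    refine (Com.runs_pour (a := (Sum.inl LIx.outR : LIx ⊕ AReg)) (b := Sum.inl LIx.src) (by simp) _).of_eq ?_ ?_
    · rw [hR3]; funext i; rcases i with i | i
      · cases i <;> simp [rfile, reverse_outRev]
      · cases i <;> simp
    · simp [rfile, outRev, encList_eq_flatMap]
  set R4 : Regs (LIx ⊕ AReg) := Sum.elim (fun i => match i with | .DN => flag dn | .src => encList items | _ => []) (file [] [] zz [] [] [] [] [])
    with hR4
  have h4 : Com.Runs (Com.clear (Sum.inl .INS) : Com (LIx ⊕ AReg)) R3 R4 (2 * cur.length + 1) := by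
    refine (Com.runs_clear (Sum.inl LIx.INS : LIx ⊕ AReg) R3).of_eq ?_ (by simp [hR3])
    rw [hR3, hR4]; funext i; rcases i with i | i
    · cases i <;> simp
    · cases i <;> simp
  have h5 : Com.Runs (Com.clear (Sum.inl .DN) : Com (LIx ⊕ AReg)) R4 (Sum.elim (srcFile (encList items)) (file [] [] zz [] [] [] [] [])) 3 := by
    refine (Com.runs_clear_flag (Sum.inl LIx.DN : LIx ⊕ AReg) (R := R4) (by simp [hR4]; exact Com.length_flag_le dn)).of_eq ?_ le_rfl
    rw [hR4]; funext i; rcases i with i | i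
    · cases i <;> simp [srcFile]
    · cases i <;> simp
  rw [hdec]
  refine (h1.seq (h2.seq (h3.seq (h4.seq h5)))).mono ?_
  have : (17 * a.length + 19 + 2) * a.length = a.length * (17 * a.length + 21) := by ring
  omega

/-! ### The sorting brick -/

/-- The sorting brick's routine: re-parse, then insertion sort (`isort`) onto the empty list.
[cite: CLRS2009, §2.1 (INSERTION-SORT)] -/
def isortC : Com (LIx ⊕ AReg) := reparseC ;; Com.isort rI

/-- `isortFn a = encList (isortModel [] (decItems a))`: the code of the decoded list sorted by
value (`isortModel`: the elements inserted in order by `List.orderedInsert`). [folklore] -/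
def isortFn (a : List Bool) : List Bool := encList (isortModel [] (decItems a))

/-- `isortFn` on a code. [folklore] -/
theorem isortFn_encList (l : List (List Bool)) : isortFn (encList l) = encList (isortModel [] l) := by
  rw [isortFn, decItems_encList]

/-- The start file of the sorting brick is the re-parse file of the input. [folklore] -/
theorem init1_lix (a : List Bool) :
    init1 (Sum.inl LIx.INS : LIx ⊕ AReg) a = Sum.elim (rfile a [] false []) (file [] [] [] [] [] [] [] []) := by
  funext i; rcases i with i | i
  · cases i <;> rfl
  · cases i <;> rfl

/-- Cost of the sorting brick in the input length. [folklore] -/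
def isortBrickCost (n : ℕ) : ℕ :=
  n * (17 * n + 21) + 20 * n + 12 + ((n + 1) * (isortStepCost n + 2) + 10 * n + 5)

/-- The length of a sorted code is that of the code. [folklore] -/
theorem length_encList_isortModel (acc l : List (List Bool)) :
    (encList (isortModel acc l)).length = (encList acc).length + (encList l).length := by
  have hp := perm_isortModel l acc
  rw [length_encList, length_encList, length_encList, (hp.map _).sum_eq, List.map_append, List.sum_append]

/-- **`isortFn ∈ FP`.** [cite: CLRS2009, §2.1 (insertion sort runs in polynomial time)] -/
theorem isortFn_mem_FP : isortFn ∈ FP := by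
  refine unOp_mem_FP isortC (Sum.inl LIx.INS) (Sum.inl LIx.lst) isortFn isortBrickCost
    (Polynomial.X * (17 * Polynomial.X + 21) + 20 * Polynomial.X + 12 +
      ((Polynomial.X + 1) * ((Polynomial.X + 1) * (45 * Polynomial.X + 30 * Polynomial.X + 50 + 2) + 28 * Polynomial.X + 24 + 2) +
        10 * Polynomial.X + 5))
    (fun n => le_of_eq ?_) (fun a => ?_) (fun a => ?_)
  · simp [isortBrickCost, isortStepCost, insCost]
  · have h1 : (isortFn a).length ≤ a.length := by
      rw [isortFn, length_encList_isortModel]; simpa using length_encList_decItems_le a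
    refine h1.trans ?_
    simp
    nlinarith [Nat.zero_le (a.length * (17 * a.length + 21)),
      Nat.zero_le ((a.length + 1) * ((a.length + 1) * (45 * a.length + 30 * a.length + 50 + 2) + 28 * a.length + 24 + 2))]
  · rw [init1_lix]
    have h1 := runs_reparse a []
    have hsz := length_encList_decItems_le a
    obtain ⟨y', h2⟩ := Com.runs_isort rI (srcFile (encList (decItems a))) [] [] (decItems a) [] a.length
      (by simp [srcFile]) (by simp [srcFile]) (by simp [srcFile]) (by simp [srcFile]) (by simp [srcFile])
      (by simp [srcFile]) (by simp [srcFile]) (by simp [srcFile]) (by simp [srcFile]) (by simp [srcFile])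
      (by simp [srcFile]) (by simp [srcFile]) (by simpa using hsz) (by simp)
    refine ⟨_, (h1.seq h2).mono ?_, ?_⟩
    · unfold isortBrickCost
      have hm : ((encList (decItems a)).length + 1) * (isortStepCost a.length + 2) ≤ (a.length + 1) * (isortStepCost a.length + 2) :=
        Nat.mul_le_mul_right _ (by omega)
      omega
    · simp [srcFile, isortFn]

end Brick

end Literature.Computability.Complexity
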